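import Summits.BirchSwinnertonDyer.BirchSwinnertonDyer.Theses.PrintX11a
import Summits.BirchSwinnertonDyer.Rank1Residual.X11a.PrintDischargeEulerHalf
import Literature.NumberTheory.GaloisRepresentations.BlochKatoSelmerGroup
import Literature.NumberTheory.EllipticCurves.GreenbergSelmer
import Literature.NumberTheory.EllipticCurves.GaloisAction
import Literature.NumberTheory.EllipticCurves.PAdicHeights
import Literature.NumberTheory.EllipticCurves.Tamagawa
import HarnessLib

/-!
# Line «kummer5» for crux `PrintX11a.UpperNonSurjFive` (stmt-BirchSwinnertonDyer-20614): the `p′`-image Kummer dichotomy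

BSD is not proved by any of this; U5 does not close by this file (five registered-shape stubs, two of them open residuals).  Written by the
ideator seat `bsd-idea-6` (gen 7, lens «decomp», crux-level only; NOT registered with `ledger skeleton check` — W-79 — the lead's skeleton of
record is untouched).  Cards: `Cruxes/UpperNonSurjFive/Ideas/kummer5.md`, `Cruxes/UpperNonSurjFive/Lines/kummer5.md`.
LABEL (first paragraph, critic V#96-P1): on the main locus the residual R₂ is EXACTLY `{p ∣ #Ш(E)}` and the line has NO class-wide engine —
R₂ is the SAME WALL as gl1cartan5's R₂ and everyone else's (`EulerSystemBigImageAtSmallImage` / the μ-roads); every closure is per pair.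
REV 2 (2026-08-28T17:1xZ, answers V#96 PASS-WITH-PRICE P1–P4): P1 this label; P2 census instrument listed in the line card (main-locus census pairs;
(A)∧(B) there ⟺ Ш(E)[5] = 0, BSD-predicted, so the per-pair computation is an UNCONDITIONAL 5-descent certificate — degree 32 at `5Ns`, 96 at `5S4`;
the records themselves are already closed by the unit-value door `PrintX11aUnitValueRecords*`, so the instrument's marginal value is beyond the
records / as an independent certificate); P3 Prasad–Shekhar citation STRUCK (unconfirmed), Wuthrich transfer caveat shared with gl1cartan5; P4 stub C
omits `¬ Surj` on purpose (a GIFT: C is true for every image), parameters named in the docstrings.  Statements UNCHANGED.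

THE LINE.  Every U5 pair (`r_an = 0`, `p ∥ N`, `E[p]` irreducible, `ρ̄_{E,p}` not surjective, `p ≥ 5`) has image `5Ns`, `5S4` or `7Ns`
[BalakrishnanEtAl2019, Zywina2015], hence `p ∤ |ρ̄_{E,p}(Γ_ℚ)|` (`|N(C_s(p))| = 2(p−1)²`, `|5S4| ∣ 96`): `H¹(ℚ, E[p]) = Hom_G(Γ_L^{ab}, E[p])`,
`L = ℚ(E[p]) ∋ μ_p`, is Kummer theory of the division field.  On the MAIN LOCUS (`p` NONSPLIT multiplicative, no split multiplicative `ℓ ≠ p`):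
* (C, `stub_control`, provable) `Sel_p(E/ℚ)` lies in (indeed equals) the GREENBERG SELMER GROUP of `E[p]` over `ℚ` — Tate line `T` at `p`
  (`ker (H¹(ℚ_p,E[p]) → H¹(ℚ_p^{ur}, E[p]/T))`), unramified classes at `ℓ ≠ p` (`p ∤ c_ℓ`), nothing at `∞` — for any `KummerDatum`
  (`M ≅ E[p]` with its Tate line); so a trivial Greenberg group gives `#Sel_p(E/ℚ) ≤ 1` and door (b)
  `ClassX11a.missingUpperBoundAt_of_card_selmerGroup_le_one` fires with (F) GZK and (I) `p`-integrality of `#Ш_an` ([Wuthrich2014] Thm. 1/4).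
* (dichotomy, proved in-file: `KummerDatum.greenberg_trivial_of`) `Sel_Gr = 0 ⟸ (A) ∧ (B)` with (A) `FineTrivial`: the strict-at-`p`
  unramified-elsewhere group `R(ℚ, E[p])` (residual fine Selmer group) vanishes, and (B) `Transverse`: `Sel_Gr ≤ R`, i.e. the line
  `loc_p H¹_{rel}(ℚ, E[p])` (one-dimensional: `h¹(ℚ_p,E[p]) − h⁰ − dim E[p]^{c=1} = 2 − 0 − 1`) is not the Tate line `im H¹(ℚ_p, T)`.  By
  inflation–restriction (`p ∤ |G|`) and Kummer theory: (A) ⟺ `Hom_G(Cl^{(p)}(L) ⊗ 𝔽_p, E[p]) = 0` (class group of `L` modulo the primes above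
  `p`; the hypothesis shape of [DeoRaySujatha2023] Thm. 3.9, tree `FineSelmerClassGroupCriterion.lean`, used here at the base and not as a road to
  Conjecture A), and (B) ⟺ the `E[p]`-isotypic unit of `L` (ONE line: multiplicity `dim E[p]^{c=1} = 1` in `𝓞_L^× ⊗ 𝔽_p`) is not a local `p`-th
  power in the étale direction above `p` (non-Wieferich; its characteristic-0 shadow — the étale `p`-adic logarithm is nonzero — is Brumer's
  theorem, the Bellaïche–Dimitrov mechanism at the weight-one point `ρ̄_{E,p} = ρ̄_g`).
* (residuals, open = U5 verbatim there) R₁ `stub_offLocus`: split multiplicative `p` (exceptional zero, line «multteich5») or a split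
  multiplicative carrier; R₂ `stub_kummerObstructed`: main-locus pairs with no datum satisfying (A) ∧ (B) — by exact control
  (`#E(ℚ_p) ⊗ 𝔽_p = p = #im H¹(ℚ_p,T)`, [Greenberg1999] §2) exactly the main-locus pairs with `p ∣ #Ш(E)`, census-empty.
COVERAGE: all three images uniformly — in particular the `5S4` pairs (31 of the 44 known `p = 5` pairs), which every earlier line (μ-roads, twins,
split-`p`, Cartan character) leaves in its residual.  HONEST: no class-wide engine — (A) and (B) are open Vandiver-type and Wieferich-type statements about
`ℚ(E[p])`, decidable per pair (degree `≤ 32` at `pNs`, `≤ 96` at `5S4`); the line is the exact, engine-free split of U5's Selmer input into two GL₁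
invariants of the division field.  Relation to «gl1cartan5»: on its Cartan sub-locus Shapiro identifies `S(𝒟_Cartan)` with `Sel_Gr` here, so the two
lines are extension (kummer5: bigger locus, split hypothesis, no `L`-value dictionary) and refinement (gl1cartan5: Rubin's criterion) of each other.

References: [Greenberg1999] (LNM 1716) §2; [MazurRubin2004] §6.2, Def. 2.1.1; [SchaeferStoll2004]; [DeoRaySujatha2023] (arXiv:2202.09937) Thm. 3.7–3.9;
[Wuthrich2014] (doi:10.4171/dm/450) Thm. 1, Thm. 4; [BalakrishnanEtAl2019] Thm. 1.2; [Zywina2015] (arXiv:1508.07660) Thm. 1.5; [Brumer1967];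
[BellaicheDimitrov2016]; [SilvermanAEC2009] VII.6.1, C.15.
-/

set_option linter.dupNamespace false
set_option autoImplicit false

noncomputable section

open scoped Classical NumberField

open WeierstrassCurve Field IsDedekindDomain
  Literature.NumberTheory.EllipticCurves
  Literature.NumberTheory.EllipticCurves.Rank1Residual
  Literature.NumberTheory.EllipticCurves.Rank1Residual.Typed
  Literature.NumberTheory.GaloisRepresentations
  Literature.NumberTheory.GaloisRepresentations.DiscreteGaloisModule
  Summit.BirchSwinnertonDyer.Rank1Residual

namespace Summit.BirchSwinnertonDyer.BirchSwinnertonDyer.Cruxes.UpperNonSurjFive.Kummer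

/-! ## §1 The Kummer datum: `E[p]` as a discrete `Γ_ℚ`-module with its Tate line at `p` -/

/-- A **Kummer datum** for the pair `(E, p)`: a discrete `Γ_ℚ`-module `M` identified `Γ_ℚ`-equivariantly with `E[p](ℚ̄)`, together
with a subgroup `T ≤ M` of order `p` which is stable under every decomposition group above `p` and modulo which every inertia group
above `p` acts trivially.  When `p` is a prime of multiplicative reduction and `ρ̄_{E,p}` has order prime to `p`, `E[p]|_{D_p} = T ⊕ (M/T)`
with `T` the TATE LINE (`μ_p ⊗ δ`, ramified) and `M/T` the étale line (`δ` unramified), and `T` is the unique such subgroup. -/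
structure KummerDatum (W : WeierstrassCurve ℚ) [W.IsElliptic] (p : ℕ) [Fact p.Prime] : Type 1 where
  /-- the module `M ≅ E[p]` -/
  M : Type
  [instAddCommGroup : AddCommGroup M]
  [instTopologicalSpace : TopologicalSpace M]
  [instDiscreteTopology : DiscreteTopology M]
  /-- the `Γ_ℚ`-action -/
  ρ : DiscreteGaloisModule ℚ M
  /-- the identification with `E[p](ℚ̄)` -/
  ι : M ≃+ (W.geomTorsion (p : ℤ))
  equivariant : ∀ (σ : absoluteGaloisGroup ℚ) (m : M), ι (ρ σ m) = σ • ι m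
  /-- the Tate line -/
  T : Submodule ℤ M
  card_T : Nat.card T = p
  /-- `T` is stable under the decomposition groups above `p` -/
  stable : ∀ (v : HeightOneSpectrum (𝓞 ℚ)) (hv : ((p : ℕ) : 𝓞 ℚ) ∈ v.asIdeal)
    (σ : absoluteGaloisGroup (v.adicCompletion ℚ)), T ≤ T.comap (GaloisRep.toLocal v ρ σ)
  /-- inertia above `p` acts trivially on `M/T` -/
  inertia_trivial_mod : ∀ (v : HeightOneSpectrum (𝓞 ℚ)), ((p : ℕ) : 𝓞 ℚ) ∈ v.asIdeal →
    ∀ σ ∈ GreenbergSelmer.inertia v, ∀ m : M, ρ σ m - m ∈ T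

attribute [instance] KummerDatum.instAddCommGroup KummerDatum.instTopologicalSpace KummerDatum.instDiscreteTopology

variable {W : WeierstrassCurve ℚ} [W.IsElliptic] {p : ℕ} [Fact p.Prime]

/-- The family of Tate lines above `p` (there is one place above `p`; the family is constant). -/
def KummerDatum.tateLines (𝒟 : KummerDatum W p) :
    ∀ v : HeightOneSpectrum (𝓞 ℚ), ((p : ℕ) : 𝓞 ℚ) ∈ v.asIdeal → Submodule ℤ 𝒟.M :=
  fun _ _ => 𝒟.T

/-- The **Greenberg Selmer structure** of `E[p]` over `ℚ`: `ker (H¹(ℚ_p, E[p]) → H¹(ℚ_p^{ur}, E[p]/T))` at `p`, unramified classes at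
every other finite place (Greenberg's `S_{E[p]}(ℚ)` for the ordinary filtration `T ⊂ E[p]`).  Parameters of `sigmaSelmerStructure p S L`:
`S = ∅` (no finite place carries the relaxed condition), `L = LocalConditionsAbove.greenberg p ρ tateLines stable` (the family `v ↦ T` of
`Γ_{ℚ_v}`-stable subgroups above `p` and its stability proof); infinite places carry no condition (`H¹(ℝ, E[p]) = 0` anyway, `p` odd). -/
def KummerDatum.greenberg (𝒟 : KummerDatum W p) : SelmerStructure 𝒟.ρ :=
  𝒟.ρ.sigmaSelmerStructure p ∅ (LocalConditionsAbove.greenberg p 𝒟.ρ 𝒟.tateLines 𝒟.stable)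

/-- The **strict (fine) Selmer structure** of `E[p]` over `ℚ`: locally trivial at `p`, unramified at every other finite place (the
residual fine Selmer group `R(ℚ, E[p])`).  Parameters: `S = ∅`, `L = LocalConditionsAbove.strict p ρ` (`L_v = ⊥` at the place above `p`). -/
def KummerDatum.strict (𝒟 : KummerDatum W p) : SelmerStructure 𝒟.ρ :=
  𝒟.ρ.sigmaSelmerStructure p ∅ (LocalConditionsAbove.strict p 𝒟.ρ)

/-- **(A) residual fine Selmer vanishing**: `R(ℚ, E[p]) = 0`.  When `ρ̄_{E,p}` has order prime to `p`, inflation–restriction to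
`L = ℚ(E[p])` makes this `Hom_{Gal(L/ℚ)}(Cl^{(p)}(L), E[p]) = 0`, `Cl^{(p)}(L)` the quotient of the class group of `L` by the classes of
the primes above `p` (a CLASS-GROUP statement about the division field; cf. the hypothesis of
`Literature.NumberTheory.EllipticCurves.DeoRaySujatha2023.thm39_fineSelmerDual_moduleFinite_of_homTrivial_divisionField`). -/
def KummerDatum.FineTrivial (𝒟 : KummerDatum W p) : Prop :=
  ∀ c ∈ 𝒟.strict.selmerGroup, c = 0

/-- **(B) transversality at `p`**: every Greenberg–Selmer class is locally trivial at `p`; equivalently the line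
`loc_p H¹_{rel}(ℚ, E[p]) ⊂ H¹(ℚ_p, E[p])` (classes unramified outside `p`) meets the Tate line `im H¹(ℚ_p, T)` trivially.  When the image
is prime to `p` this is a statement about the `E[p]`-isotypic UNIT of `L = ℚ(E[p])` (Kummer theory, `μ_p ⊂ L` by the Weil pairing):
it is not a local `p`-th power in the étale direction at the primes above `p` — a non-Wieferich condition. -/
def KummerDatum.Transverse (𝒟 : KummerDatum W p) : Prop :=
  𝒟.greenberg.selmerGroup ≤ 𝒟.strict.selmerGroup

/-- `(A) ∧ (B) ⇒` the Greenberg Selmer group of `E[p]` over `ℚ` vanishes (two lines). -/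
theorem KummerDatum.greenberg_trivial_of (𝒟 : KummerDatum W p) (hA : 𝒟.FineTrivial) (hB : 𝒟.Transverse) :
    ∀ c ∈ 𝒟.greenberg.selmerGroup, c = 0 :=
  fun c hc => hA c (hB hc)

/-! ## §2 The main locus and the stubs -/

/-- The **main locus** of the line: `p` is NONSPLIT multiplicative for `E` and no prime `ℓ ≠ p` is split multiplicative (no Tamagawa
number is divisible by `p ≥ 5`, no exceptional-zero phenomenon at `p`). -/
def MainLocus (W : WeierstrassCurve ℚ) [W.IsElliptic] (p : ℕ) [Fact p.Prime] : Prop :=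
  W.HasMultiplicativeReductionAtPrime p ∧ ∀ (ℓ : ℕ) [Fact ℓ.Prime], ¬ W.HasSplitMultiplicativeReductionAtPrime ℓ

/-- **Stub C (Greenberg control at the base, provable, M–L).**  On the main locus the `p`-Selmer group of `E/ℚ` injects into the
Greenberg Selmer group of any Kummer datum: `Sel_p(E/ℚ) ⊂ H¹(ℚ, E[p]) ≅ H¹(ℚ, M)`; at `ℓ ≠ p` the Kummer condition is the unramified one
(`p ∤ c_ℓ`: additive `c_ℓ ≤ 4`, nonsplit multiplicative `c_ℓ ≤ 2`, and for additive `ℓ` the inertia action on `T_p E` factors through a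
group of order prime to `p ≥ 5`); at nonsplit multiplicative `p`, `E(ℚ_p) ⊗ 𝔽_p = Ê(pℤ_p) ⊗ 𝔽_p` lies in the image of `H¹(ℚ_p, T)`
(Tate curve over the unramified quadratic extension), which is Greenberg's condition; `H¹(ℝ, E[p]) = 0` (`p` odd).  Hence a trivial
Greenberg Selmer group forces `#Sel_p(E/ℚ) ≤ 1`.  The hypothesis `¬ Surj W p` of U5 is deliberately ABSENT (a gift: the inclusion
`Sel_p(E/ℚ) ⊆ Sel_Gr` holds for every image; the `p′`-image only makes (A), (B) Kummer-theoretic), and on the main locus the inclusion is an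
EQUALITY (`H¹_ur(ℚ_p, M/T) = 0` as `δ(Frob_p) = −1`, so the Greenberg condition is `im H¹(ℚ_p,T)`, of order `p = #Ê ⊗ 𝔽_p`) — not needed here.
[Greenberg 1999 (LNM 1716) §2, corpus:book:coates1999 p.82/p.93; Mazur–Rubin 2004 §6.2; Silverman AEC C.15, VII.6.1] -/
theorem stub_control : ∀ (W : WeierstrassCurve ℚ) [W.IsElliptic] [W.IsGloballyMinimal] (p : ℕ) [Fact p.Prime],
    ClassX11a W p → 5 ≤ p → MainLocus W p → ¬ W.HasSplitMultiplicativeReductionAtPrime p →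
    ∀ 𝒟 : KummerDatum W p, (∀ c ∈ 𝒟.greenberg.selmerGroup, c = 0) → Nat.card (W.selmerGroup (p : ℤ)) ≤ 1 := by
  sorry

/-- **Stub I (`p`-integrality of `#Ш_an`, print).**  Identical to line «gl1cartan5» stub I: on `ClassX11a` pairs with `p ≥ 5` and no
split multiplicative prime, `#Ш_an(E) ∈ ℚ` with `ord_p ≥ 0` ([Wuthrich2014] (doi:10.4171/dm/450) Thm. 1 + Thm. 4 for the lattice `E•`,
`p′`-isogeny invariance since `E[p]` is irreducible, `p ∤ #E(ℚ)_tors · ∏ c_ℓ`; GZK for `L(E,1)/Ω ∈ ℚ`). -/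
theorem stub_shaAnIntegral : ∀ (W : WeierstrassCurve ℚ) [W.IsElliptic] [W.IsGloballyMinimal] (p : ℕ) [Fact p.Prime],
    ClassX11a W p → 5 ≤ p → (∀ (ℓ : ℕ) [Fact ℓ.Prime], ¬ W.HasSplitMultiplicativeReductionAtPrime ℓ) →
    ∃ q : ℚ, shaAn W = (q : ℂ) ∧ 0 ≤ padicValRat p q := by
  sorry

/-- **Stub F (print fact, Gross–Zagier–Kolyvagin).**  `rank E(ℚ) = ord_{s=1} L(E,s)` when the latter is `≤ 1`. -/
theorem stub_rankFact : rank_eq_analyticRank_of_analyticRank_le_one := by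
  sorry

/-- **Stub R₁ (off-locus residual, open = U5 verbatim there).**  `p` split multiplicative (exceptional zero; line «multteich5») or a
split multiplicative carrier `ℓ ≠ p` (`p ∣ c_ℓ`: the Kummer condition at `ℓ` is no longer the unramified one). -/
theorem stub_offLocus : ∀ (W : WeierstrassCurve ℚ) [W.IsElliptic] [W.IsGloballyMinimal] (p : ℕ) [Fact p.Prime],
    ClassX11a W p → ¬ Surj W p → 5 ≤ p → ¬ MainLocus W p → MissingUpperBoundAt W p := by
  sorry

/-- **Stub R₂ (Kummer-obstructed residual, open = U5 verbatim there).**  Main-locus pairs at which NO Kummer datum has (A) ∧ (B).  By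
stub C's converse (exact control: `#E(ℚ_p) ⊗ 𝔽_p = p = #im H¹(ℚ_p, T)` at nonsplit `p`, so the Kummer and Greenberg conditions
coincide) these are exactly the main-locus pairs with `Sel_p(E/ℚ) ≠ 0`, i.e. (rank `0`, `E(ℚ)[p] = 0`) with `p ∣ #Ш(E)` — census-empty
for every known pair, and precisely the pairs where U5 needs the full `p`-part of BSD. -/
theorem stub_kummerObstructed : ∀ (W : WeierstrassCurve ℚ) [W.IsElliptic] [W.IsGloballyMinimal] (p : ℕ) [Fact p.Prime],
    ClassX11a W p → ¬ Surj W p → 5 ≤ p → MainLocus W p →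
    (∀ 𝒟 : KummerDatum W p, ¬ (𝒟.FineTrivial ∧ 𝒟.Transverse)) → MissingUpperBoundAt W p := by
  sorry

/-! ## §3 Composition -/

/-- The typed statements of the five stubs, as `Prop`s (for the hypothesis-form composition). -/
def Control : Prop := ∀ (W : WeierstrassCurve ℚ) [W.IsElliptic] [W.IsGloballyMinimal] (p : ℕ) [Fact p.Prime],
    ClassX11a W p → 5 ≤ p → MainLocus W p → ¬ W.HasSplitMultiplicativeReductionAtPrime p →
    ∀ 𝒟 : KummerDatum W p, (∀ c ∈ 𝒟.greenberg.selmerGroup, c = 0) → Nat.card (W.selmerGroup (p : ℤ)) ≤ 1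

def ShaAnIntegral : Prop := ∀ (W : WeierstrassCurve ℚ) [W.IsElliptic] [W.IsGloballyMinimal] (p : ℕ) [Fact p.Prime],
    ClassX11a W p → 5 ≤ p → (∀ (ℓ : ℕ) [Fact ℓ.Prime], ¬ W.HasSplitMultiplicativeReductionAtPrime ℓ) →
    ∃ q : ℚ, shaAn W = (q : ℂ) ∧ 0 ≤ padicValRat p q

def OffLocusResidual : Prop := ∀ (W : WeierstrassCurve ℚ) [W.IsElliptic] [W.IsGloballyMinimal] (p : ℕ) [Fact p.Prime],
    ClassX11a W p → ¬ Surj W p → 5 ≤ p → ¬ MainLocus W p → MissingUpperBoundAt W p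

def KummerObstructedResidual : Prop := ∀ (W : WeierstrassCurve ℚ) [W.IsElliptic] [W.IsGloballyMinimal] (p : ℕ) [Fact p.Prime],
    ClassX11a W p → ¬ Surj W p → 5 ≤ p → MainLocus W p →
    (∀ 𝒟 : KummerDatum W p, ¬ (𝒟.FineTrivial ∧ 𝒟.Transverse)) → MissingUpperBoundAt W p

/-- **Composition (kernel-checked modulo the stubs): C, I, F, R₁, R₂ ⊢ U5.**  On the main locus with a Kummer datum satisfying (A) ∧ (B):
Greenberg Selmer group trivial (two lines) ⇒ `#Sel_p(E/ℚ) ≤ 1` (C) ⇒ door (b)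
`ClassX11a.missingUpperBoundAt_of_card_selmerGroup_le_one` with (F) and (I); otherwise R₂; off the locus R₁. -/
theorem UpperNonSurjFive_of_hyps (hC : Control) (hI : ShaAnIntegral) (hF : rank_eq_analyticRank_of_analyticRank_le_one)
    (hR₁ : OffLocusResidual) (hR₂ : KummerObstructedResidual) : Theses.PrintX11a.UpperNonSurjFive := by
  intro W _ _ p _ hX hns hp5
  by_cases hL : MainLocus W p
  · by_cases hS : ∃ 𝒟 : KummerDatum W p, 𝒟.FineTrivial ∧ 𝒟.Transverse
    · obtain ⟨𝒟, hA, hB⟩ := hS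
      obtain ⟨q, hq, hv⟩ := hI W p hX hp5 hL.2
      exact hX.missingUpperBoundAt_of_card_selmerGroup_le_one hF hq hv
        (hC W p hX hp5 hL (hL.2 p) 𝒟 (𝒟.greenberg_trivial_of hA hB))
    · exact hR₂ W p hX hns hp5 hL (fun 𝒟 h𝒟 => hS ⟨𝒟, h𝒟⟩)
  · exact hR₁ W p hX hns hp5 hL

/-- **The line: U5 from the five stubs.** -/
theorem UpperNonSurjFive_of_kummer : Theses.PrintX11a.UpperNonSurjFive :=
  UpperNonSurjFive_of_hyps stub_control stub_shaAnIntegral stub_rankFact stub_offLocus stub_kummerObstructed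

end Summit.BirchSwinnertonDyer.BirchSwinnertonDyer.Cruxes.UpperNonSurjFive.Kummer

end
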